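import Literature.NumberTheory.GaloisRepresentations.ContinuousShapiroOpenCoinducedRightAction
import HarnessLib

/-!
# Prime-to-`p` descent along an open normal subgroup: `Hⁿ(G, M) ≅ Hⁿ(G, Maps(G ⧸ W, M))^{G ⧸ W}`
# for `pM = 0` and `p ∤ [G : W]` (Serre, *Corps locaux* VII §5–§6; NSW (1.6.4) + (1.5.7))

Topic `NumberTheory/GaloisRepresentations` (continuous cochain cohomology); namespace
`Literature.NumberTheory.GaloisRepresentations` (dot notation under `ContinuousRep`).  Definitions
with bodies (the trace `Maps(G ⧸ W, M) → M` and the descent isomorphism) and theorems; no named fact,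
no `sorry`, no instance, no notation.

Let `G` be a compact topological group, `W ⊴ G` open normal, `Δ = G ⧸ W`, `m = [G : W]`, and `M` a
discrete `G`-module.  With the unit `u : M → Maps(Δ, M)` (constants; `ρ.coindOpenUnit`) and the
TRACE `r : Maps(Δ, M) → M`, `φ ↦ Σ_y φ(y)` (`ρ.coindOpenTrace`, a `G`-morphism) one has
`r ∘ u = m` and `u ∘ r = Σ_{c ∈ Δ} R_c` (the norm of the right `Δ`-action of
`ContinuousShapiroOpenCoinducedRightAction`).  Passing to `Hⁿ(G, –)` (ADDITIVE in the morphism: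
`cohomologyMap_comp_apply_of_sum`, `cohomologyMap_comp_apply_of_nsmul`, proved here on homogeneous cochains):
`Hⁿ(r) ∘ Hⁿ(u) = m` and `Hⁿ(u) ∘ Hⁿ(r) = Σ_c c·(–)`.  Hence, **if `pM = 0` for a prime `p` with
`p ∤ m`** (so `m` acts invertibly on all these `𝔽_p`-spaces):

  **`Hⁿ(u) : Hⁿ(G, M) ⥲ Hⁿ(G, Maps(G ⧸ W, M))^Δ`**   (`ρ.descentEquiv W hW n`),

i.e. — through Shapiro's lemma `Hⁿ(G, Maps(G ⧸ W, M)) ≅ Hⁿ(W, M)` (`ContinuousRep.shapiroOpenAddEquiv`)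
— the classical `res : Hⁿ(G, M) ⥲ Hⁿ(W, M)^{G/W}` for `[G : W]` prime to the exponent of `M`
(NSW (1.6.4) with Cor. (1.5.7): `cor ∘ res = m`), obtained here WITHOUT any conjugation action on
`Hⁿ(W, M)`: the `Δ`-action is the right-translation action `ρ.coindOpenHRep` on the coefficients.

* §1 additivity of `Hⁿ(G, –)` in the morphism (`cohomologyMap_comp_apply_of_sum`, `_of_nsmul`, `_of_eq`, `_of_zero`, `cohomologyMap_id_apply`);
* §2 the trace `coindOpenTrace`, `r ∘ u = m`, `Σ_c R_c = u ∘ r`;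
* §3 on cohomology: `Hⁿ(r) ∘ Hⁿ(u) = m`, `Σ_c c • x = Hⁿ(u) (Hⁿ(r) x)`, `p • x = 0` on `Hⁿ` when
  `pM = 0`;
* §4 the descent: injectivity of `Hⁿ(u)`, its range `=` the `Δ`-invariants, `descentEquiv`, and
  `Nat.card Hⁿ(G, M) = Nat.card Hⁿ(G, Maps(G ⧸ W, M))^Δ`.

Lane «TATE-EPC-TC» of cell `bsd-eis` (crux `GoodLatticeBDPValue`, stmt-BirchSwinnertonDyer-19032),
brick B5 (the "prime-to-`p` step": for `Δ = Gal(L/K₁)` of order prime to `p` and `M` killed by `p`,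
`#Hⁿ(G_{K₁,S}, M)` is the number of `Δ`-invariants of `Hⁿ(G_{L,S}, M)` in the right-action model;
Milne ADT I §5, proof of Thm. 5.1: "`θ ∘ χ′ = χ`, `θ([N]) = #N^Ḡ`").  HONEST FRAMING: homological
algebra of profinite groups only; no arithmetic statement and no case of BSD is proved here.

## References
* J.-P. Serre, *Corps locaux* / *Local Fields* (1979), VII §5–§6 (`G/H`-action, induced modules,
  `Res`/`Cor`). [SerreLocalFields1979]
* J. Neukirch, A. Schmidt, K. Wingberg, *Cohomology of Number Fields*, 2nd ed. (2008), (1.5.7)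
  (`cor ∘ res = (G : H)`), (1.6.4) (Shapiro). [NeukirchSchmidtWingberg2008]
* J. S. Milne, *Arithmetic Duality Theorems*, 2nd ed. (2006), I §5 (proof of Thm. 5.1: `θ ∘ χ′ = χ`).
  [MilneADT2006]
-/

noncomputable section

open CategoryTheory Function
open scoped Topology

universe u w

namespace Literature.NumberTheory.GaloisRepresentations

open _root_.TopRep _root_.ContRepresentation _root_.ContinuousCohomology

/-! ## §1 Additivity of `Hⁿ(G, –)` in the morphism -/

section Additivity

variable {k : Type w} [Ring k] [TopologicalSpace k]
variable {G : Type u} [Group G] [TopologicalSpace G] [IsTopologicalGroup G]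
variable {A B : TopRep.{u} k G}

/-- Classes of finite sums of cycles are the sums of the classes. [cite: SerreGaloisCohomology1997, I §2.2] -/
theorem cxClass_sum {ι : Type*} (K : HomologicalComplex (TopModuleCat.{u} k) (ComplexShape.up ℕ))
    (i j : ℕ) (hj : (ComplexShape.up ℕ).next i = j) (s : Finset ι) (x : ι → K.X i)
    (hx : ∀ a, K.d i j (x a) = 0) :
    cxClass K i j hj (∑ a ∈ s, x a) (by rw [map_sum]; exact Finset.sum_eq_zero fun a _ => hx a) =
      ∑ a ∈ s, cxClass K i j hj (x a) (hx a) := by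
  subst hj
  unfold cxClass
  have hmem : ∀ a, x a ∈ (K.sc i).g.hom.ker := fun a => hx a
  have hx' : (⟨∑ a ∈ s, x a, Submodule.sum_mem _ fun a _ => hmem a⟩ :
      (K.sc i).g.hom.ker) = ∑ a ∈ s, ⟨x a, hmem a⟩ :=
    Subtype.ext (by rw [AddSubmonoidClass.coe_finsetSum])
  exact (congrArg (kerToHomology (K.sc i)) hx').trans (map_sum _ _ _)

/-- **`Hⁿ(G, –)` is additive in the morphism, composite finite-sum form**: if
`g ∘ f = Σ_{i ∈ s} F_i` pointwise, then `Hⁿ(g) (Hⁿ(f) x) = Σ_{i ∈ s} Hⁿ(F_i) x` (on homogeneous cochains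
the induced maps are post-composition, computed degree by degree).  The cases `s = ∅`, `#s = 1` and
`F_i = 𝟙` give the vanishing, comparison and scalar forms below.
[cite: SerreGaloisCohomology1997, I §2.2] -/
theorem cohomologyMap_comp_apply_of_sum {C : TopRep.{u} k G} {ι : Type*} (f : A ⟶ B) (g : B ⟶ C)
    (s : Finset ι) (F : ι → (A ⟶ C)) (hh : ∀ v : A, g.hom (f.hom v) = ∑ i ∈ s, (F i).hom v) (n : ℕ)
    (x : continuousCohomology n A) :
    cohomologyMap g n (cohomologyMap f n x) = ∑ i ∈ s, cohomologyMap (F i) n x := by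
  have hres : ∀ (m : ℕ) (v : resolutionX A m), (resolutionHom g m).hom ((resolutionHom f m).hom v) =
      ∑ i ∈ s, (resolutionHom (F i) m).hom v := by
    intro m
    induction m with
    | zero => intro v; exact hh v
    | succ m ih =>
      intro Φ
      ext y
      rw [resolutionHom_succ_hom_apply, resolutionHom_succ_hom_apply, ih, ContinuousMap.coe_sum,
        Finset.sum_apply]
      rfl
  have hcoch : ∀ (i : ℕ) (σ : (homogeneousCochains A).X i),
      (cochainsHom g).f i ((cochainsHom f).f i σ) = ∑ a ∈ s, (cochainsHom (F a)).f i σ := fun i σ =>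
    Subtype.ext (by
      rw [cochainsHom_f_coe, cochainsHom_f_coe, hres]
      erw [AddSubmonoidClass.coe_finsetSum]
      rfl)
  obtain ⟨σ, hσ, rfl⟩ := cxClass_surjective (homogeneousCochains A) n (n + 1) (up_nat_next n) x
  have hσf : (homogeneousCochains B).d n (n + 1) ((cochainsHom f).f n σ) = 0 := by
    rw [hom_f_d_apply, hσ, map_zero]
  have hσa : ∀ a, (homogeneousCochains C).d n (n + 1) ((cochainsHom (F a)).f n σ) = 0 := fun a => by
    rw [hom_f_d_apply, hσ, map_zero]
  change HomologicalComplex.homologyMap (cochainsHom g) n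
    (HomologicalComplex.homologyMap (cochainsHom f) n _) = _
  rw [homologyMap_cxClass (cochainsHom f) n (n + 1) (up_nat_next n) σ hσ _ hσf rfl,
    homologyMap_cxClass (cochainsHom g) n (n + 1) (up_nat_next n) _ hσf _
      (by rw [map_sum]; exact Finset.sum_eq_zero fun a _ => hσa a) (hcoch n σ).symm,
    cxClass_sum _ n (n + 1) (up_nat_next n) s _ hσa]
  refine Finset.sum_congr rfl fun a _ => ?_
  change _ = HomologicalComplex.homologyMap (cochainsHom (F a)) n _
  rw [homologyMap_cxClass (cochainsHom (F a)) n (n + 1) (up_nat_next n) σ hσ _ (hσa a) rfl]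

/-- `Hⁿ(𝟙) x = x`. [cite: SerreGaloisCohomology1997, I §2.2] -/
theorem cohomologyMap_id_apply (n : ℕ) (x : continuousCohomology n A) : cohomologyMap (𝟙 A) n x = x := by
  rw [show cohomologyMap (𝟙 A) n = 𝟙 _ from
    continuousCohomology_map_eq_id (ContinuousMonoidHom.id G) (resIdHom (𝟙 A)) rfl (fun _ => rfl) n]
  rfl

/-- **If `g ∘ f = m` pointwise then `Hⁿ(g) ∘ Hⁿ(f) = m`.** [cite: SerreGaloisCohomology1997, I §2.2] -/
theorem cohomologyMap_comp_apply_of_nsmul (f : A ⟶ B) (g : B ⟶ A) (m : ℕ)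
    (hh : ∀ v : A, g.hom (f.hom v) = m • v) (n : ℕ) (x : continuousCohomology n A) :
    cohomologyMap g n (cohomologyMap f n x) = m • x := by
  rw [cohomologyMap_comp_apply_of_sum f g (Finset.range m) (fun _ => 𝟙 A)
    (fun v => by rw [hh, Finset.sum_const, Finset.card_range]; rfl) n x, Finset.sum_const,
    Finset.card_range, cohomologyMap_id_apply]

/-- **If `g ∘ f = h` pointwise then `Hⁿ(g) ∘ Hⁿ(f) = Hⁿ(h)`.** [cite: SerreGaloisCohomology1997, I §2.2] -/
theorem cohomologyMap_comp_apply_of_eq {C : TopRep.{u} k G} (f : A ⟶ B) (g : B ⟶ C) (h : A ⟶ C)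
    (hh : ∀ v : A, g.hom (f.hom v) = h.hom v) (n : ℕ) (x : continuousCohomology n A) :
    cohomologyMap g n (cohomologyMap f n x) = cohomologyMap h n x := by
  rw [cohomologyMap_comp_apply_of_sum f g (Finset.univ : Finset Unit) (fun _ => h)
    (fun v => by rw [hh, Finset.sum_const, Finset.card_univ, Fintype.card_unit, one_smul]) n x,
    Finset.sum_const, Finset.card_univ, Fintype.card_unit, one_smul]

/-- **If `g ∘ f = 0` pointwise then `Hⁿ(g) ∘ Hⁿ(f) = 0`.** [cite: SerreGaloisCohomology1997, I §2.2] -/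
theorem cohomologyMap_comp_apply_of_zero {C : TopRep.{u} k G} (f : A ⟶ B) (g : B ⟶ C)
    (hh : ∀ v : A, g.hom (f.hom v) = 0) (n : ℕ) (x : continuousCohomology n A) :
    cohomologyMap g n (cohomologyMap f n x) = 0 := by
  rw [cohomologyMap_comp_apply_of_sum f g (∅ : Finset Unit) (fun _ => 0)
    (fun v => by rw [hh, Finset.sum_empty]) n x, Finset.sum_empty]

end Additivity

namespace ContinuousRep

/-! ## §2 The trace `Maps(G ⧸ W, M) → M` -/

section Trace

variable {G : Type u} [Group G] [TopologicalSpace G] [IsTopologicalGroup G] [CompactSpace G]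
variable {M : Type u} [AddCommGroup M] [TopologicalSpace M] [DiscreteTopology M]
variable (ρ : ContinuousRep G ℤ M) (W : Subgroup G) [W.Normal] (hW : IsOpen (W : Set G))
  [Fintype (G ⧸ W)]

/-- **The trace `r : Maps(G ⧸ W, M) → M`, `φ ↦ Σ_y φ(y)`**, a morphism of topological
representations (`Σ_y g • φ(g⁻¹ y) = g • Σ_y φ(y)`). [cite: SerreLocalFields1979, VII §6] -/
def coindOpenTrace : (ρ.coindOpen W hW).toTopRep ⟶ ρ.toTopRep :=
  TopRep.ofHom
    { toLinearMap :=
        { toFun := fun φ => ∑ y : G ⧸ W, φ y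
          map_add' := fun φ ψ => by
            change ∑ y : G ⧸ W, (φ y + ψ y) = _
            rw [Finset.sum_add_distrib]
          map_smul' := fun n φ => by
            change ∑ y : G ⧸ W, n • φ y = _
            rw [← Finset.smul_sum]
            rfl }
      cont := continuous_finsetSum _ fun y _ => _root_.continuous_apply y
      isIntertwining' := fun g => by
        ext φ
        change ∑ y : G ⧸ W, ρ g (φ (g⁻¹ • y)) = ρ g (∑ y : G ⧸ W, φ y)
        rw [map_sum]
        exact Fintype.sum_equiv (MulAction.toPerm g⁻¹) _ _ fun y => rfl }

omit [W.Normal] in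
/-- Formula: `coindOpenTrace φ = Σ_y φ(y)`. [cite: SerreLocalFields1979, VII §6] -/
@[simp] theorem coindOpenTrace_apply (φ : G ⧸ W → M) :
    (ρ.coindOpenTrace W hW).hom φ = ∑ y : G ⧸ W, φ y := rfl

omit [W.Normal] in
/-- **`r ∘ u = [G : W]`**: the trace of a constant function. [cite: NeukirchSchmidtWingberg2008, (1.5.7)] -/
theorem coindOpenTrace_coindOpenUnit (v : M) :
    (ρ.coindOpenTrace W hW).hom ((ρ.coindOpenUnit W hW).hom v) = Fintype.card (G ⧸ W) • v := by
  rw [coindOpenTrace_apply]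
  change ∑ _y : G ⧸ W, v = _
  rw [Finset.sum_const, Finset.card_univ]

/-- **`Σ_{c ∈ Δ} R_c = u ∘ r`** on `Maps(G ⧸ W, M)`: `Σ_c φ(y c) = Σ_z φ(z)` for every `y`.
[cite: SerreLocalFields1979, VII §5] -/
theorem sum_coindOpenRTrans_apply (φ : G ⧸ W → M) :
    ∑ c : G ⧸ W, (ρ.coindOpenRTrans W hW c).hom φ =
      (ρ.coindOpenUnit W hW).hom ((ρ.coindOpenTrace W hW).hom φ) := by
  funext y
  rw [Finset.sum_apply, coindOpenTrace_apply]
  change ∑ c : G ⧸ W, φ (y * c) = ∑ z : G ⧸ W, φ z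
  exact Fintype.sum_equiv (Equiv.mulLeft y) _ _ fun c => rfl

/-- The trace is invariant under the right translations: `r ∘ R_c = r`. [cite: SerreLocalFields1979, VII §5] -/
theorem coindOpenTrace_coindOpenRTrans (c : G ⧸ W) (φ : G ⧸ W → M) :
    (ρ.coindOpenTrace W hW).hom ((ρ.coindOpenRTrans W hW c).hom φ) = (ρ.coindOpenTrace W hW).hom φ := by
  rw [coindOpenTrace_apply, coindOpenTrace_apply]
  change ∑ y : G ⧸ W, φ (y * c) = ∑ y : G ⧸ W, φ y
  exact Fintype.sum_equiv (Equiv.mulRight c) _ _ fun y => rfl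

end Trace

/-! ## §3 On cohomology -/

section Cohomology

variable {G : Type u} [Group G] [TopologicalSpace G] [IsTopologicalGroup G] [CompactSpace G]
variable {M : Type u} [AddCommGroup M] [TopologicalSpace M] [DiscreteTopology M]
variable (ρ : ContinuousRep G ℤ M) (W : Subgroup G) [W.Normal] (hW : IsOpen (W : Set G))
  [Fintype (G ⧸ W)]

omit [Fintype (G ⧸ W)] in
/-- The `Δ`-action in the coercion spelling of `cohomologyMap`: `c • x = Hⁿ(R_c) x`.
[cite: SerreLocalFields1979, VII §5] -/
theorem coindOpenHRep_apply' (n : ℕ) (c : G ⧸ W) (x : continuousCohomology n (ρ.coindOpen W hW).toTopRep) :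
    ρ.coindOpenHRep W hW n c x = cohomologyMap (ρ.coindOpenRTrans W hW c) n x := rfl

omit [W.Normal] in
/-- **`Hⁿ(r) ∘ Hⁿ(u) = [G : W]`** on `Hⁿ(G, M)` (= `cor ∘ res`, NSW (1.5.7), in the coinduced model).
[cite: NeukirchSchmidtWingberg2008, (1.5.7)] -/
theorem cohomologyMap_trace_unit (n : ℕ) (x : continuousCohomology n ρ.toTopRep) :
    cohomologyMap (ρ.coindOpenTrace W hW) n (cohomologyMap (ρ.coindOpenUnit W hW) n x) =
      Fintype.card (G ⧸ W) • x :=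
  cohomologyMap_comp_apply_of_nsmul (ρ.coindOpenUnit W hW) (ρ.coindOpenTrace W hW)
    (Fintype.card (G ⧸ W)) (fun v => ρ.coindOpenTrace_coindOpenUnit W hW v) n x

/-- **The norm of the `Δ`-action factors through `Hⁿ(G, M)`**: `Σ_c c • x = Hⁿ(u) (Hⁿ(r) x)`.
[cite: SerreLocalFields1979, VII §5] [cite: NeukirchSchmidtWingberg2008, (1.5.7)] -/
theorem sum_coindOpenHRep_apply (n : ℕ) (x : continuousCohomology n (ρ.coindOpen W hW).toTopRep) :
    ∑ c : G ⧸ W, ρ.coindOpenHRep W hW n c x =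
      cohomologyMap (ρ.coindOpenUnit W hW) n (cohomologyMap (ρ.coindOpenTrace W hW) n x) := by
  simp only [coindOpenHRep_apply']
  exact (cohomologyMap_comp_apply_of_sum (ρ.coindOpenTrace W hW) (ρ.coindOpenUnit W hW)
    (Finset.univ : Finset (G ⧸ W)) (fun c => ρ.coindOpenRTrans W hW c)
    (fun φ => (ρ.sum_coindOpenRTrans_apply W hW φ).symm) n x).symm

/-- `Hⁿ(r)` is invariant under the `Δ`-action: `Hⁿ(r) (c • x) = Hⁿ(r) x`. [cite: SerreLocalFields1979, VII §5] -/
theorem cohomologyMap_trace_coindOpenHRep (n : ℕ) (c : G ⧸ W)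
    (x : continuousCohomology n (ρ.coindOpen W hW).toTopRep) :
    cohomologyMap (ρ.coindOpenTrace W hW) n (ρ.coindOpenHRep W hW n c x) =
      cohomologyMap (ρ.coindOpenTrace W hW) n x := by
  rw [coindOpenHRep_apply']
  exact cohomologyMap_comp_apply_of_eq (ρ.coindOpenRTrans W hW c) (ρ.coindOpenTrace W hW)
    (ρ.coindOpenTrace W hW) (fun φ => ρ.coindOpenTrace_coindOpenRTrans W hW c φ) n x

omit [Fintype (G ⧸ W)] in
/-- `Hⁿ(u) x` is `Δ`-invariant: `c • Hⁿ(u) x = Hⁿ(u) x` (`R_c ∘ u = u`). [cite: SerreLocalFields1979, VII §5] -/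
theorem coindOpenHRep_cohomologyMap_unit (n : ℕ) (c : G ⧸ W) (x : continuousCohomology n ρ.toTopRep) :
    ρ.coindOpenHRep W hW n c (cohomologyMap (ρ.coindOpenUnit W hW) n x) =
      cohomologyMap (ρ.coindOpenUnit W hW) n x := by
  rw [coindOpenHRep_apply']
  exact cohomologyMap_comp_apply_of_eq (ρ.coindOpenUnit W hW) (ρ.coindOpenRTrans W hW c)
    (ρ.coindOpenUnit W hW) (fun _ => rfl) n x

omit [CompactSpace G] [Fintype (G ⧸ W)] [W.Normal] in
/-- **If `p • M = 0` then `p • Hⁿ(G, M) = 0`** (the zero endomorphism of `M` is "multiplication by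
`p`" and induces `0 = p • (–)`). [cite: SerreGaloisCohomology1997, I §2.2] -/
theorem nsmul_eq_zero_of_forall (p : ℕ) (hp : ∀ v : M, (p : ℤ) • v = 0) (n : ℕ)
    (x : continuousCohomology n ρ.toTopRep) : p • x = 0 := by
  have h1 := cohomologyMap_comp_apply_of_nsmul (0 : ρ.toTopRep ⟶ ρ.toTopRep)
    (0 : ρ.toTopRep ⟶ ρ.toTopRep) p (fun v => by rw [← natCast_zsmul, hp]; rfl) n x
  rw [cohomologyMap_comp_apply_of_zero (0 : ρ.toTopRep ⟶ ρ.toTopRep) (0 : ρ.toTopRep ⟶ ρ.toTopRep)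
    (fun _ => rfl) n x] at h1
  exact h1.symm

end Cohomology

/-! ## §4 The descent isomorphism -/

section Descent

variable {G : Type u} [Group G] [TopologicalSpace G] [IsTopologicalGroup G] [CompactSpace G]
variable {M : Type u} [AddCommGroup M] [TopologicalSpace M] [DiscreteTopology M]
variable (ρ : ContinuousRep G ℤ M) (W : Subgroup G) [W.Normal] (hW : IsOpen (W : Set G))
  [Fintype (G ⧸ W)] {p : ℕ}

omit [TopologicalSpace G] [IsTopologicalGroup G] [CompactSpace G] [TopologicalSpace M]
  [DiscreteTopology M] [W.Normal] in
/-- Bézout: if `p ∤ [G : W]` and `p • x = 0` then `x = a • ([G : W] • x)` for a fixed integer `a`.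
[cite: NeukirchSchmidtWingberg2008, (1.5.7)] -/
theorem exists_zsmul_card_nsmul_eq (hp : p.Prime) (hcop : ¬ p ∣ Fintype.card (G ⧸ W)) :
    ∃ a : ℤ, ∀ {V : Type u} [AddCommGroup V] (x : V), p • x = 0 →
      a • (Fintype.card (G ⧸ W) • x) = x := by
  have hc : Nat.Coprime (Fintype.card (G ⧸ W)) p :=
    (Nat.Prime.coprime_iff_not_dvd hp).2 hcop |>.symm
  obtain ⟨a, b, hab⟩ : IsCoprime (Fintype.card (G ⧸ W) : ℤ) (p : ℤ) :=
    Nat.isCoprime_iff_coprime.2 hc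
  refine ⟨a, fun x hx => ?_⟩
  have h1 : (a * Fintype.card (G ⧸ W) + b * p) • x = x := by rw [hab, one_smul]
  rw [add_smul, mul_smul, mul_smul, natCast_zsmul, natCast_zsmul, hx, smul_zero, add_zero] at h1
  exact h1

omit [W.Normal] in
/-- **`Hⁿ(u)` is injective** when `pM = 0` and `p ∤ [G : W]` (`Hⁿ(r) ∘ Hⁿ(u) = m` is invertible).
[cite: NeukirchSchmidtWingberg2008, (1.5.7) and (1.6.4)] -/
theorem cohomologyMap_coindOpenUnit_injective (hp : p.Prime) (hpM : ∀ v : M, (p : ℤ) • v = 0)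
    (hcop : ¬ p ∣ Fintype.card (G ⧸ W)) (n : ℕ) :
    Function.Injective (cohomologyMap (ρ.coindOpenUnit W hW) n) := by
  obtain ⟨a, ha⟩ := exists_zsmul_card_nsmul_eq W hp hcop
  intro x y hxy
  rw [← ha x (ρ.nsmul_eq_zero_of_forall p hpM n x), ← ha y (ρ.nsmul_eq_zero_of_forall p hpM n y),
    ← ρ.cohomologyMap_trace_unit W hW n x, ← ρ.cohomologyMap_trace_unit W hW n y, hxy]

/-- **The range of `Hⁿ(u)` is the module of `Δ`-invariants** of `Hⁿ(G, Maps(G ⧸ W, M))` when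
`pM = 0` and `p ∤ [G : W]` (`⊆`: `R_c ∘ u = u`; `⊇`: an invariant `x` satisfies `m • x = Σ_c c • x =
Hⁿ(u)(Hⁿ(r) x)`). [cite: SerreLocalFields1979, VII §5–§6] [cite: NeukirchSchmidtWingberg2008, (1.6.4)] -/
theorem mem_range_cohomologyMap_coindOpenUnit_iff (hp : p.Prime) (hpM : ∀ v : M, (p : ℤ) • v = 0)
    (hcop : ¬ p ∣ Fintype.card (G ⧸ W)) (n : ℕ) (y : continuousCohomology n (ρ.coindOpen W hW).toTopRep) :
    y ∈ Set.range (cohomologyMap (ρ.coindOpenUnit W hW) n) ↔ y ∈ (ρ.coindOpenHRep W hW n).invariants := by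
  obtain ⟨a, ha⟩ := exists_zsmul_card_nsmul_eq W hp hcop
  constructor
  · rintro ⟨x, rfl⟩ c
    exact ρ.coindOpenHRep_cohomologyMap_unit W hW n c x
  · intro hy
    have hpy : p • y = 0 :=
      (ρ.coindOpen W hW).nsmul_eq_zero_of_forall p (natCast_smul_coindOpen_eq_zero W hpM) n y
    have hsum : ∑ c : G ⧸ W, ρ.coindOpenHRep W hW n c y = Fintype.card (G ⧸ W) • y := by
      rw [Finset.sum_congr rfl fun c _ => hy c, Finset.sum_const, Finset.card_univ]
    refine ⟨a • cohomologyMap (ρ.coindOpenTrace W hW) n y, ?_⟩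
    rw [map_zsmul, ← ρ.sum_coindOpenHRep_apply W hW n y, hsum]
    exact ha y hpy

/-- **Prime-to-`p` descent: `Hⁿ(G, M) ≃+ Hⁿ(G, Maps(G ⧸ W, M))^{G ⧸ W}`** for `pM = 0` and
`p ∤ [G : W]`, induced by the unit `M → Maps(G ⧸ W, M)` (through Shapiro: `res : Hⁿ(G, M) ⥲
Hⁿ(W, M)^{G/W}`). [cite: NeukirchSchmidtWingberg2008, (1.6.4) and (1.5.7)] [cite: SerreLocalFields1979, VII §5–§6] -/
def descentEquiv (hp : p.Prime) (hpM : ∀ v : M, (p : ℤ) • v = 0) (hcop : ¬ p ∣ Fintype.card (G ⧸ W))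
    (n : ℕ) : (continuousCohomology n ρ.toTopRep : Type u) ≃+ (ρ.coindOpenHRep W hW n).invariants :=
  AddEquiv.ofBijective
    ({ toFun := fun x => ⟨cohomologyMap (ρ.coindOpenUnit W hW) n x,
          fun c => ρ.coindOpenHRep_cohomologyMap_unit W hW n c x⟩
       map_zero' := Subtype.ext (map_zero _)
       map_add' := fun x y => Subtype.ext (map_add _ x y) } :
      (continuousCohomology n ρ.toTopRep : Type u) →+ (ρ.coindOpenHRep W hW n).invariants)
    ⟨fun x y hxy => ρ.cohomologyMap_coindOpenUnit_injective W hW hp hpM hcop n (congrArg Subtype.val hxy),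
      fun y => by
        obtain ⟨x, hx⟩ := (ρ.mem_range_cohomologyMap_coindOpenUnit_iff W hW hp hpM hcop n y).2 y.2
        exact ⟨x, Subtype.ext hx⟩⟩

/-- Formula: `descentEquiv x = Hⁿ(u) x`. [cite: NeukirchSchmidtWingberg2008, (1.6.4)] -/
theorem descentEquiv_apply_coe (hp : p.Prime) (hpM : ∀ v : M, (p : ℤ) • v = 0)
    (hcop : ¬ p ∣ Fintype.card (G ⧸ W)) (n : ℕ) (x : continuousCohomology n ρ.toTopRep) :
    ((ρ.descentEquiv W hW hp hpM hcop n x : (ρ.coindOpenHRep W hW n).invariants) :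
      continuousCohomology n (ρ.coindOpen W hW).toTopRep) =
      cohomologyMap (ρ.coindOpenUnit W hW) n x := rfl

/-- **`#Hⁿ(G, M) = #Hⁿ(G, Maps(G ⧸ W, M))^{G ⧸ W}`** for `pM = 0`, `p ∤ [G : W]`.
[cite: NeukirchSchmidtWingberg2008, (1.6.4) and (1.5.7)] [cite: MilneADT2006, I §5 (proof of Thm. 5.1)] -/
theorem natCard_continuousCohomology_eq_natCard_invariants (hp : p.Prime)
    (hpM : ∀ v : M, (p : ℤ) • v = 0) (hcop : ¬ p ∣ Fintype.card (G ⧸ W)) (n : ℕ) :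
    Nat.card (continuousCohomology n ρ.toTopRep) = Nat.card (ρ.coindOpenHRep W hW n).invariants :=
  Nat.card_congr (ρ.descentEquiv W hW hp hpM hcop n).toEquiv

end Descent

end ContinuousRep

end Literature.NumberTheory.GaloisRepresentations

end
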